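import Summits.AtomisticToContinuum.Crystallization.Theses.NashClassCertificates
import Summits.AtomisticToContinuum.Crystallization.Theorems.NashClassCertificatesNashHullBridge

/-!
# Route `NashClassCertificates`: the deciding theorem from the WEAKEST energetic hypothesis —
# the vanishing bad fraction of Lennard-Jones ground states

Companion of `NashClassCertificatesNashTwoShellGapCrystallizationOfBadPhaseGap.lean` (line `bulk_dilute` of crux
`NashTwoShellGap`, stmt-AtomisticToContinuum-16826).  `closes` consumes its crux only through the statement

  `GroundStateBadFractionVanishes`: along every sequence of LJ ground states, `#bad(x_N)/N → 0`

(`LayeredWindowsLocal.badFraction_of_nashTwoShellGap`); the crux implies it, and so does the Nash-free flat bad-phase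
gap alone (`stub_badFractionOfBadPhaseGap`, p161727).  This file records the re-glue at its root (registered sub-goal
`stub_crystallizationOfBadFraction`): `GroundStateBadFractionVanishes → NashNearField → PeriodicGivenLayered →
Crystallization`, by the proof of `closes` with `goodWindows_of_badFraction` in place of `goodWindows_of_nashTwoShellGap`.
So the minimal energetic ask of THIS route is the qualitative two-shell crystallization of ground states in density
(cf. `ZeroDefectDensity`, stmt-12086, its one-shell analogue); every gap statement (crux 16826, 13956, the torus gap,
the bad-phase gap) is a quantitative sufficient condition for it.  No definitions; all `[folklore]`.
-/

noncomputable section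

namespace Summit.AtomisticToContinuum.Crystallization.Theorems.NashTwoShellGapCrystallizationOfBadFraction

open scoped BigOperators Classical
open Filter
open Literature.MathematicalPhysics.StatisticalMechanics Literature.Geometry.DiscreteGeometry
open Summit.AtomisticToContinuum.Crystallization.Theses

/-- **Layered windows from the vanishing bad fraction and the Nash near field.** [folklore] -/
theorem layeredWindows_of_badFraction
    (hbf : (∀ x : (N : ℕ) → (Fin N → EuclideanSpace ℝ (Fin 3)), (∀ N, Literature.MathematicalPhysics.StatisticalMechanics.IsGroundState Literature.MathematicalPhysics.StatisticalMechanics.lennardJones (x N)) → Filter.Tendsto (fun N : ℕ => (Nat.card {i : Fin N // ¬ Literature.Geometry.DiscreteGeometry.IsTwoShellGood (1 / 20) (47 / 50) 1 (x N) i} : ℝ) / N) Filter.atTop (nhds 0)))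
    (hNF : NashClassCertificates.NashNearField) : NashClassCertificates.LayeredWindows :=
  fun x hx => LayeredWindowsLocal.layeredWindows_seq_of_goodWindows hNF x hx
    (fun ρ => LayeredWindowsLocal.goodWindows_of_badFraction x hx (hbf x hx) ρ)

/-- **Registered sub-goal `stub_crystallizationOfBadFraction`** — the deciding theorem of route `NashClassCertificates`
from the vanishing bad fraction of ground states (in place of the crux `NashTwoShellGap`), the Nash near field and
periodic-given-layered. [folklore] -/
theorem stub_crystallizationOfBadFraction : (∀ x : (N : ℕ) → (Fin N → EuclideanSpace ℝ (Fin 3)), (∀ N, Literature.MathematicalPhysics.StatisticalMechanics.IsGroundState Literature.MathematicalPhysics.StatisticalMechanics.lennardJones (x N)) → Filter.Tendsto (fun N : ℕ => (Nat.card {i : Fin N // ¬ Literature.Geometry.DiscreteGeometry.IsTwoShellGood (1 / 20) (47 / 50) 1 (x N) i} : ℝ) / N) Filter.atTop (nhds 0)) → Summit.AtomisticToContinuum.Crystallization.Theses.NashClassCertificates.NashNearField → Summit.AtomisticToContinuum.Crystallization.Theses.NashClassCertificates.PeriodicGivenLayered → _root_.Crystallization := by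
  intro hbf hNF hPGL
  have hLW : NashClassCertificates.LayeredWindows := layeredWindows_of_badFraction hbf hNF
  have hPW : NashClassCertificates.PeriodicWindows := fun y hy => hPGL y hy (hLW y hy)
  have hpos : IsCrystallizing lennardJones 3 := PrestressSplitKorn.stub_hullCriterion hPW
  obtain ⟨x, hx⟩ : ∃ x : (N : ℕ) → (Fin N → EuclideanSpace ℝ (Fin 3)), ∀ N, IsGroundState lennardJones (x N) :=
    ⟨fun N => (LennardJonesGroundStatesExist_holds N).choose,
      fun N => (LennardJonesGroundStatesExist_holds N).choose_spec⟩
  obtain ⟨P, hP⟩ := hPW x hx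
  have hleast : IsLeast (Set.range fun Q : PeriodicConfiguration 3 => Q.energyPerParticle lennardJones)
      (P.energyPerParticle lennardJones) :=
    windowOptimality_proof x hx P hP
  have hinf : (⨅ Q : PeriodicConfiguration 3, Q.energyPerParticle lennardJones) =
      P.energyPerParticle lennardJones := hleast.csInf_eq
  have hlim : Tendsto (fun N : ℕ => groundStateEnergy lennardJones 3 N / N) atTop
      (nhds (P.energyPerParticle lennardJones)) := by
    have h0 : Tendsto (fun N : ℕ => groundStateEnergy lennardJones 3 N / N) atTop
        (nhds (⨅ Q : PeriodicConfiguration 3, Q.energyPerParticle lennardJones)) := crysEnergyLimit_proof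
    rw [hinf] at h0
    exact h0
  exact ⟨⟨P, hleast, hlim⟩, hpos⟩

end Summit.AtomisticToContinuum.Crystallization.Theorems.NashTwoShellGapCrystallizationOfBadFraction

end
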